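/-
Copyright (c) 2026 the pub-hodgecm-mathlib formalisation cell (harness21).  Prover seat hodgecm-mathlib-K2E4-p14 (g9), Track B ∕ K2-LIT, h413 = `stmt-HodgeConjecture-24833`,
line `K2_E1_TraceFormulaBeta`, campaign 5Res ∕ 12R3 (ROADCARD §3′ M2 v2), deal (237) of the dealer K2E1-plan (g7): THE TOP ASSEMBLY OF THE D-ROAD, generic adelic datum `𝒢` (serves
5Res at `U(1,1)` and 12R3 at `U(2,1)` alike) — «ATOMS ⇒ every `(χ, U)`-eigenspace of `L²_res` is finite-dimensional», i.e. the `hfin` binder of ★ K2E4-p11's `finiteDimensional_homRangeSum_of_level_finite` VERBATIM; by name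
then the `hadm` binder of ★ `residualSpectrumCompact_of_admissible` and `R(f)|_{L²_res}` compact.
-/
import Summits.HodgeConjecture.HodgeConjecture.Theorems.K2E1KTypeLevelReductionU          -- ★ (K2E4-p11, (233) FILE 2): `finiteDimensional_homRangeSum_of_level_finite` — a K-type lives at one (χ, U)
import Summits.HodgeConjecture.HodgeConjecture.Theorems.K2E1ResidualPartSpanIrreduciblesU  -- ★ p860092 (K2E4-p23, D5′-pre): `residualSubspace_eq_iSupClosure` — `L²_res` = closed span of the irreducibles ⊥ cusp
import Summits.HodgeConjecture.HodgeConjecture.Theorems.K2E1ResidualCompactOfAdmissible    -- ★ (K2E1-p02): `residualSpectrumCompact_of_admissible` — the admissibility entrance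
import HarnessLib

/-!
# K2·E1 — `K2E1ResidualLevelFiniteOfAtomsU`: ATOMS ⟹ every `(χ, U)`-eigenspace of `L²_res` is finite-dimensional ⟹ `L²_res` is `K`-admissible ⟹ `R(f)|_{L²_res}` compact
# (the top assembly of the D-road, generic `𝒢`)

Track B ∕ K2-LIT, crux h413 = `stmt-HodgeConjecture-24833`, route of record `HCCMUnconditional`; cell `hodgecm-mathlib`, squad K2, ENGINE E1 (campaign 5Res ∕ 12R3, ROADCARD §3′ M2 v2).
THEOREMS ONLY (no `def`, no `instance`, no notation, no named-fact hypothesis, no `sorry`); lane `--supports stmt-HodgeConjecture-24833 --as helper` (count-neutral).  Closes no socket.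

THE ARGUMENT (dealer (237)).  `L²_res = closure Σ_W W` over the irreducible closed `G(𝔸)`-stable `W ⊥ L²_cusp` (★ D5′-pre `residualSubspace_eq_iSupClosure`, LETTER-FREE).  Fix a compact
`K →* G(𝔸)` with an abelian-central factor `ιa : T →* K` and a profinite factor `ιf : K_f →* K`.  By ★ K2E4-p11's `finiteDimensional_homRangeSum_of_level_finite` a finite-dimensional
irreducible `K`-type `E ≤ L²_res` has its isotypic part inside the joint eigenspace `L²_res^{(χ,U)} = {x | σ(u)x = x (u ∈ U), σ(t)x = χ(t)x}` of some character `χ : T →* ℂ` and some open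
subgroup `U ≤ K_f` (Schur + no small subgroups); so `L²_res` is `K`-admissible as soon as every `L²_res^{(χ,U)}` is finite-dimensional.  **ATOMS** (the payers' currency: D5′ proper +
(FIN), K2E4-p23∕K2E4-p10∕K2E2-p12): for each `(χ, U)` a continuous linear `P` on `L²` FIXING the `(χ,U)`-eigenvectors of `R ∘ ιK` (in print `P = R(e_χ ⊗ e_U)`; only this fixing
property is used — no self-adjointness, idempotence or `W`-stability) and a FINITE-DIMENSIONAL `A ≤ L²` with `P(W) ⊆ A` for every irreducible `W ⊥ L²_cusp`.  THEN every
`x ∈ L²_res^{(χ,U)}` is a limit of finite sums of vectors of such `W`, `x = P x` is a limit of vectors of `P(Σ W) ⊆ A`, and `A` is closed (finite-dimensional): `x ∈ A` (§1).  Hence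
`L²_res^{(χ,U)} ↪ A` is finite-dimensional, `hadm` holds (§2), and ★ `residualSpectrumCompact_of_admissible` gives `R(f)|_{L²_res}` compact (§3).
* §1 `mem_of_mem_topologicalClosure_biSup` — ABSTRACT (normed `ℂ`-space): a `P`-fixed point of the closed span of a family whose members `P` maps into a finite-dimensional `A` lies in `A`.
* §2 HEAD **`levelFinite_of_atoms`** — the `hfin` binder of ★ `finiteDimensional_homRangeSum_of_level_finite` VERBATIM (eigenspace form, `σ := (residualSubspace 𝒢 μ 𝔓).toContRep.restrict ιK`
  composed with `ιa ∕ ιf`), from `hatoms` alone (atoms indexed by the irreducible `W ≤ L²_res`; the projector letters used: `P` continuous linear and the identity on the `(χ,U)`-eigenvectors).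
* §3 BY NAME: **`residual_admissible_of_atoms`** (the `hadm` binder of ★ :256, via ★ K2E4-p11 + `hcont`, `ιa` central, `K_f` profinite) and **`residualSpectrumCompact_of_atoms`**
  (`ResidualSpectrumCompact 𝒢 μ 𝔓`; + `K` compact Hausdorff, `ιK` continuous, `G(𝔸)` locally compact).
HONEST LABEL: HC_CM is proved only modulo the 7 printed citations (2 remaining named inputs: hLiu418 = `stmt-HodgeConjecture-24832`, h413 = `stmt-HodgeConjecture-24833`) until rung 0
closes; this file asserts no named fact and closes no socket; count-neutral; CONDITIONAL on the ATOMS (visible binder `hatoms`) — 5Res ∕ 12R3 stay OPEN until the payers land them.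

## References
* [MoeglinWaldspurger1995] C. Mœglin, J.-L. Waldspurger, *Spectral decomposition and Eisenstein series* (1995), I.2.18, V.3.13.
* [HarishChandra1968] Harish-Chandra, *Automorphic forms on semisimple Lie groups*, LNM 62 (1968), Thm. 1.
* [BorelJacquet1979] A. Borel, H. Jacquet, *Automorphic forms and automorphic representations*, Corvallis I (1979), §4.6.
* [Dixmier1977] J. Dixmier, *C\*-algebras* (1977), §13.1.
-/

set_option autoImplicit false
-- the mandated namespace repeats the single-problem summit's segment (`HodgeConjecture.HodgeConjecture`)
set_option linter.dupNamespace false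

noncomputable section

open MeasureTheory Filter Topology Set
open scoped InnerProductSpace
open Literature.NumberTheory.Automorphic ContRepresentation
open Summit.HodgeConjecture.HodgeConjecture.Cruxes.H413.K2E1CuspidalSpectrumUnitary
open Summit.HodgeConjecture.HodgeConjecture.Cruxes.H413.K2E1KTypeLevelReductionU (finiteDimensional_homRangeSum_of_level_finite)
open Summit.HodgeConjecture.HodgeConjecture.Cruxes.H413.K2E1ResidualPartSpanIrreduciblesU (residualSubspace_eq_iSupClosure)
open Summit.HodgeConjecture.HodgeConjecture.Cruxes.H413.K2E1ResidualCompactOfAdmissible (residualSpectrumCompact_of_admissible)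

namespace Summit.HodgeConjecture.HodgeConjecture.Cruxes.H413.K2E1ResidualLevelFiniteOfAtomsU

universe u

/-! ## §1 A fixed point of `P` in the closed span of a family that `P` maps into a finite-dimensional `A` lies in `A` -/

section Abstract

variable {H : Type*} [NormedAddCommGroup H] [NormedSpace ℂ H]

/-- **ABSTRACT ATOM LEMMA**: `P : H →L[ℂ] H` continuous linear, `A ≤ H` finite-dimensional, `f i ≤ H` (`i ∈ S`) submodules with `P (f i) ⊆ A`; if `x` lies in the closure of `⨆_{i ∈ S} f i`
and `P x = x`, then `x ∈ A` — `P` maps the algebraic span into `A`, hence (continuity) its closure into `closure A = A` (finite-dimensional subspaces are closed). [cite: Dixmier1977, §13.1] -/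
theorem mem_of_mem_topologicalClosure_biSup {ι : Type*} (S : Set ι) (f : ι → Submodule ℂ H) (P : H →L[ℂ] H) (A : Submodule ℂ H) [FiniteDimensional ℂ A]
    (hA : ∀ i ∈ S, ∀ w ∈ f i, P w ∈ A) {x : H} (hx : x ∈ (⨆ i ∈ S, f i).topologicalClosure) (hPx : P x = x) : x ∈ A := by
  have hle : (⨆ i ∈ S, f i) ≤ A.comap (P : H →ₗ[ℂ] H) :=
    iSup₂_le fun i hi w hw => Submodule.mem_comap.2 (hA i hi w hw)
  have hmaps : MapsTo P ((⨆ i ∈ S, f i : Submodule ℂ H) : Set H) (A : Set H) := fun w hw => hle hw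
  have hcl : P x ∈ closure (A : Set H) := map_mem_closure P.continuous (by rwa [← Submodule.topologicalClosure_coe]) hmaps
  rw [A.closed_of_finiteDimensional.closure_eq] at hcl
  rwa [hPx] at hcl

end Abstract

/-! ## §2 HEAD: ATOMS ⟹ every `(χ, U)`-eigenspace of `L²_res` is finite-dimensional (the `hfin` binder of ★ `finiteDimensional_homRangeSum_of_level_finite`) -/

section Residual

variable {F : Type} [Field F] [NumberField F] (𝒢 : AdelicGroupData.{u} F) (μ : Measure 𝒢.automorphicQuotient) [𝒢.IsAutomorphicMeasure μ]
  (𝔓 : 𝒢.ParabolicUnipotentData)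

/-- **ATOMS ⟹ LEVEL-FINITENESS OF THE RESIDUAL SPECTRUM** (dealer (237); generic `𝒢`).  Data: `ιK : K →* G(𝔸)`, `ιa : T →* K`, `ιf : K_f →* K`; the ATOMS `hatoms`: for every
`χ : T →* ℂ` and every open subgroup `U ≤ K_f`, a continuous linear `P` on `L²` which is the identity on every `x` with `R(ιK ιf u) x = x` (`u ∈ U`) and `R(ιK ιa t) x = χ t • x` (in print
`P = R(e_χ ⊗ e_U)`, K2E2-p12's (S2c)), and a finite-dimensional `A ≤ L²` with `P(W) ⊆ A` for every topologically irreducible closed subrepresentation `W ≤ L²_res` of `R` (D5′ + (FIN)).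
CONCLUSION: the `hfin` binder of ★ K2E4-p11's `finiteDimensional_homRangeSum_of_level_finite` VERBATIM for `σ := (residualSubspace 𝒢 μ 𝔓).toContRep.restrict ιK` — every joint
eigenspace `(⨅_{u ∈ U} ker(σ(ιf u) − 1)) ⊓ ⨅_t ker(σ(ιa t) − χ t)` of `L²_res` is finite-dimensional: it embeds in `A` (★ D5′-pre `residualSubspace_eq_iSupClosure` + §1).
[cite: MoeglinWaldspurger1995, I.2.18 and V.3.13] [cite: HarishChandra1968, Thm. 1] [cite: BorelJacquet1979, §4.6] -/
theorem levelFinite_of_atoms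
    {K : Type*} [Group K] (ιK : K →* 𝒢.Adelic) {T : Type*} [Group T] (ιa : T →* K) {Kf : Type*} [Group Kf] [TopologicalSpace Kf] (ιf : Kf →* K)
    (hatoms : ∀ (χ : T →* ℂ) (U : OpenSubgroup Kf), ∃ (P : 𝒢.L2 μ →L[ℂ] 𝒢.L2 μ) (A : Submodule ℂ (𝒢.L2 μ)), FiniteDimensional ℂ A ∧
      (∀ x : 𝒢.L2 μ, (∀ u ∈ U, 𝒢.rightRegular μ (ιK (ιf u)) x = x) → (∀ t : T, 𝒢.rightRegular μ (ιK (ιa t)) x = χ t • x) → P x = x) ∧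
      ∀ W : ClosedSubrep (𝒢.rightRegular μ), W.toContRep.IsTopIrreducible → W ≤ residualSubspace 𝒢 μ 𝔓 → ∀ w ∈ W, P w ∈ A) :
    ∀ (χ : T →* ℂ) (U : OpenSubgroup Kf),
      FiniteDimensional ℂ ↥((⨅ u : U, Module.End.eigenspace ((((residualSubspace 𝒢 μ 𝔓).toContRep.restrict ιK) (ιf (u : Kf))).toLinearMap) 1) ⊓
        ⨅ t : T, Module.End.eigenspace ((((residualSubspace 𝒢 μ 𝔓).toContRep.restrict ιK) (ιa t)).toLinearMap) (χ t)) := by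
  intro χ U
  obtain ⟨P, A, hAfd, hPfix, hPW⟩ := hatoms χ U
  haveI := hAfd
  set J : Submodule ℂ (residualSubspace 𝒢 μ 𝔓).toSubmodule :=
    (⨅ u : U, Module.End.eigenspace ((((residualSubspace 𝒢 μ 𝔓).toContRep.restrict ιK) (ιf (u : Kf))).toLinearMap) 1) ⊓
      ⨅ t : T, Module.End.eigenspace ((((residualSubspace 𝒢 μ 𝔓).toContRep.restrict ιK) (ιa t)).toLinearMap) (χ t) with hJ
  -- the irreducible `W ⊥ L²_cusp` lie in `L²_res` (★ D5′-pre), so `P` maps them into `A`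
  have hPW' : ∀ W ∈ {W : ClosedSubrep (𝒢.rightRegular μ) | W.toContRep.IsTopIrreducible ∧ W ≤ (𝒢.cuspidalSubspace μ 𝔓).orthogonal (𝒢.isUnitary_rightRegular μ)},
      ∀ w ∈ W.toSubmodule, P w ∈ A := fun W hW w hw =>
    hPW W hW.1 (by rw [residualSubspace_eq_iSupClosure]; exact ClosedSubrep.le_iSupClosure hW) w hw
  -- every vector of the joint eigenspace lies (as a vector of `L²`) in the atom `A`
  have hJA : ∀ y : (residualSubspace 𝒢 μ 𝔓).toSubmodule, y ∈ J → (y : 𝒢.L2 μ) ∈ A := by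
    intro y hy
    obtain ⟨hyU, hyT⟩ := Submodule.mem_inf.1 hy
    have h1 : ∀ u ∈ U, 𝒢.rightRegular μ (ιK (ιf u)) (y : 𝒢.L2 μ) = y := fun u hu => by
      have h := (Submodule.mem_iInf _).1 hyU ⟨u, hu⟩
      rw [Module.End.mem_eigenspace_iff, one_smul] at h
      exact congrArg Subtype.val h
    have h2 : ∀ t : T, 𝒢.rightRegular μ (ιK (ιa t)) (y : 𝒢.L2 μ) = χ t • (y : 𝒢.L2 μ) := fun t => by
      have h := (Submodule.mem_iInf _).1 hyT t
      rw [Module.End.mem_eigenspace_iff] at h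
      exact congrArg Subtype.val h
    have hPy : P (y : 𝒢.L2 μ) = y := hPfix _ h1 h2
    have hyres : (y : 𝒢.L2 μ) ∈ ClosedSubrep.iSupClosure {W : ClosedSubrep (𝒢.rightRegular μ) |
        W.toContRep.IsTopIrreducible ∧ W ≤ (𝒢.cuspidalSubspace μ 𝔓).orthogonal (𝒢.isUnitary_rightRegular μ)} :=
      (residualSubspace_eq_iSupClosure 𝒢 μ 𝔓).le y.2
    exact mem_of_mem_topologicalClosure_biSup {W : ClosedSubrep (𝒢.rightRegular μ) | W.toContRep.IsTopIrreducible ∧ W ≤ (𝒢.cuspidalSubspace μ 𝔓).orthogonal (𝒢.isUnitary_rightRegular μ)}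
      (fun W => W.toSubmodule) P A hPW' hyres hPy
  -- hence the joint eigenspace embeds linearly into `A`
  let φ : J →ₗ[ℂ] A := LinearMap.codRestrict A ((residualSubspace 𝒢 μ 𝔓).toSubmodule.subtype ∘ₗ J.subtype) fun y => hJA y.1 y.2
  refine FiniteDimensional.of_injective φ fun a b hab => ?_
  have h := congrArg Subtype.val hab
  exact Subtype.ext (Subtype.ext h)

/-! ## §3 BY NAME: `L²_res` is `K`-admissible, and `R(f)|_{L²_res}` is compact -/

/-- **ATOMS ⟹ THE RESIDUAL SPECTRUM IS `K`-ADMISSIBLE**: the `hadm` binder of ★ `residualSpectrumCompact_of_admissible` VERBATIM — §2's `hfin` fed BY NAME to ★ K2E4-p11's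
`finiteDimensional_homRangeSum_of_level_finite` (`ιa` central, `K_f` compact Hausdorff totally disconnected with continuous orbit maps on `L²_res`).
[cite: MoeglinWaldspurger1995, I.2.18 and V.3.13] [cite: HarishChandra1968, Thm. 1] -/
theorem residual_admissible_of_atoms
    {K : Type*} [Group K] (ιK : K →* 𝒢.Adelic)
    {T : Type*} [Group T] (ιa : T →* K) (hιa : ∀ (t : T) (k : K), ιa t * k = k * ιa t)
    {Kf : Type*} [Group Kf] [TopologicalSpace Kf] [IsTopologicalGroup Kf] [CompactSpace Kf] [T2Space Kf] [TotallyDisconnectedSpace Kf] (ιf : Kf →* K)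
    (hcont : ∀ v : (residualSubspace 𝒢 μ 𝔓).toSubmodule, Continuous fun k : Kf => ((residualSubspace 𝒢 μ 𝔓).toContRep.restrict ιK) (ιf k) v)
    (hatoms : ∀ (χ : T →* ℂ) (U : OpenSubgroup Kf), ∃ (P : 𝒢.L2 μ →L[ℂ] 𝒢.L2 μ) (A : Submodule ℂ (𝒢.L2 μ)), FiniteDimensional ℂ A ∧
      (∀ x : 𝒢.L2 μ, (∀ u ∈ U, 𝒢.rightRegular μ (ιK (ιf u)) x = x) → (∀ t : T, 𝒢.rightRegular μ (ιK (ιa t)) x = χ t • x) → P x = x) ∧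
      ∀ W : ClosedSubrep (𝒢.rightRegular μ), W.toContRep.IsTopIrreducible → W ≤ residualSubspace 𝒢 μ 𝔓 → ∀ w ∈ W, P w ∈ A) :
    ∀ (E : Submodule ℂ (residualSubspace 𝒢 μ 𝔓).toSubmodule)
      (hE : ∀ k, ∀ x ∈ E, ((residualSubspace 𝒢 μ 𝔓).toContRep.restrict ιK) k x ∈ E), FiniteDimensional ℂ E →
      (((residualSubspace 𝒢 μ 𝔓).toContRep.restrict ιK).subRep E hE).IsIrreducible →
      FiniteDimensional ℂ (Representation.homRangeSum ((residualSubspace 𝒢 μ 𝔓).toContRep.restrict ιK).toRepresentation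
        (((residualSubspace 𝒢 μ 𝔓).toContRep.restrict ιK).subRep E hE)) := by
  intro E hE hEfd hirr
  haveI := hEfd
  exact finiteDimensional_homRangeSum_of_level_finite ((residualSubspace 𝒢 μ 𝔓).toContRep.restrict ιK) ιa hιa ιf hcont
    (levelFinite_of_atoms 𝒢 μ 𝔓 ιK ιa ιf hatoms) E hE hirr

/-- **ATOMS ⟹ `ResidualSpectrumCompact 𝒢 μ 𝔓`**: ★ `residualSpectrumCompact_of_admissible` fed with §2 (`K` compact Hausdorff with continuous `ιK`, `G(𝔸)` locally compact).  For
`𝒢 = U(Φ_N)∕CM` and the radicals of record this is 5Res (`N = 2`) ∕ 12R3 (`N = 3`) modulo the atoms. [cite: MoeglinWaldspurger1995, I.2.18 and V.3.13] [cite: HarishChandra1968, Thm. 1] -/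
theorem residualSpectrumCompact_of_atoms [LocallyCompactSpace 𝒢.Adelic]
    {K : Type*} [Group K] [TopologicalSpace K] [IsTopologicalGroup K] [CompactSpace K] [T2Space K] (ιK : K →* 𝒢.Adelic) (hι : Continuous ιK)
    {T : Type*} [Group T] (ιa : T →* K) (hιa : ∀ (t : T) (k : K), ιa t * k = k * ιa t)
    {Kf : Type*} [Group Kf] [TopologicalSpace Kf] [IsTopologicalGroup Kf] [CompactSpace Kf] [T2Space Kf] [TotallyDisconnectedSpace Kf] (ιf : Kf →* K)
    (hcont : ∀ v : (residualSubspace 𝒢 μ 𝔓).toSubmodule, Continuous fun k : Kf => ((residualSubspace 𝒢 μ 𝔓).toContRep.restrict ιK) (ιf k) v)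
    (hatoms : ∀ (χ : T →* ℂ) (U : OpenSubgroup Kf), ∃ (P : 𝒢.L2 μ →L[ℂ] 𝒢.L2 μ) (A : Submodule ℂ (𝒢.L2 μ)), FiniteDimensional ℂ A ∧
      (∀ x : 𝒢.L2 μ, (∀ u ∈ U, 𝒢.rightRegular μ (ιK (ιf u)) x = x) → (∀ t : T, 𝒢.rightRegular μ (ιK (ιa t)) x = χ t • x) → P x = x) ∧
      ∀ W : ClosedSubrep (𝒢.rightRegular μ), W.toContRep.IsTopIrreducible → W ≤ residualSubspace 𝒢 μ 𝔓 → ∀ w ∈ W, P w ∈ A) :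
    ResidualSpectrumCompact 𝒢 μ 𝔓 :=
  residualSpectrumCompact_of_admissible 𝒢 μ 𝔓 ιK hι (residual_admissible_of_atoms 𝒢 μ 𝔓 ιK ιa hιa ιf hcont hatoms)

end Residual

end Summit.HodgeConjecture.HodgeConjecture.Cruxes.H413.K2E1ResidualLevelFiniteOfAtomsU

end
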